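import Summits.QuantumFields.YangMills.Theorems.BalabanUVNodesN15SmallFieldSiteLayerCovariant
import Summits.QuantumFields.YangMills.Theorems.BalabanUVNodesN15SmallFieldUnitLayerCovariant
import Summits.QuantumFields.YangMills.Theorems.BalabanUVNodesN15SmallFieldAllLayersDirichletKnit
import HarnessLib

/-!
# N15 = NE2 — PROGRAMME Q «COVARIANT AVERAGE IN THE SANDWICH», part (Q-5): ★★★ THE ALL-LIVE KNIT WITH A COVARIANTLY PERTURBED AVERAGING AND A GENUINE DIRICHLET REGION — `Live ∧ N15At` for
# dag-n15-c's live small-field family with OPERATOR Σ-F, SITE (Q-3) `foSiteCov`, UNIT (Q-4) `foCovCovLam` (`inΛ := inLamSf`), for EVERY averaging-perturbation family with the displayed rows;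
# the family-parametric closed literal `sfObjects₄covQLam … wQLam`, keyed face
# (dag-n15-a g31, FILE (Q-5); node N15 = NE2; `--supports stmt-QuantumFields-27366 --as helper`, count-neutral; 2 plumbing defs + theorems; imports (Q-3), (Q-4), (Ð-5))

WHY.  (Ð-5) `live_and_n15At_sf₄cov_allLiveLam` is this lane's most print-faithful literal so far (all three layers U-live, genuine Dirichlet region), its site∕unit sandwich averaging FLATLY
(`Q ⊗ 1`).  (Q-3)∕(Q-4) proved the site∕unit templates for the sandwich with `Q⊗1 + D`, `Q*⊗1 + E` for EVERY perturbation family `(Dc, Ec, Df, Ef)` with DISPLAYED rows ([B9] (3.81)'s size +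
a two-grid comparison, in a small-field window `c₃₅L^mα₀ ≤ s₀`).  This file is (Ð-5) §2–§3 with those layers: for every such family there is a cube floor `w` at which the sub-family «large cube × origin-anchored region» passes
dag-n15-w2's guard and `N15At` — so that the covariant averaging of n15-c∕181 (`qvCov`∕`qvCovAdj`, rows 182 + a comparison sequel) yields `Live ∧ N15At` for the covariantly averaged literal by
`exact`.  The operator layer is Σ-F's `ne2PlusOperator_sf₄cov` (entry 2 forward; the adjoint-entry edition (∂-1)∕(∂-2) is the one-line twin once its olean is served).

WHAT.  §1 ★★★ `live_and_n15At_sf₄cov_covQ_allLiveLam Dc Ec Df Ef hfam : ∃ w, Live ⟨SfIdxGE d L w × RegIdx0 d, …, foSiteCov …, foCovCovLam …, inLamSf, dist⟩ ∧ N15At {…}` (OPERATOR Σ-F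
restricted, SITE (Q-3) restricted (`d′ := 4`), UNIT (Q-4), GUARD (Ð-5) `live_sfGELam`).  §2 def `sfObjects₄covQLam … Dc Ec Df Ef … w : NE2Objects₁₁` (`rfl` to the bundle),
`exists_live_and_n15At_sfObjects₄covQLam`, def `wQLam` (the pinned threshold: a `Classical.choose` — NON-EXPLICIT cube floor depending on the family and on the proof of its rows, said),
★★★ `live_and_n15At_sfObjects₄covQLam_wQLam` (CLOSED literal given the family: guard ∧ `N15At`), keyed face `s_N15_of_admits_sf₄covQLam` (part 30's interface).

HONEST FRAMING ∕ LIMITS.  By-name composition over (Q-3), (Q-4), Σ-F, (Ð-5)'s guard; the covariant averaging MODELLED as `Q⊗1 + D` with D's rows DISPLAYED (hypothesis `hfam`) — the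
family is a PARAMETER here, no perturbation is constructed (n15-c∕181 `qvCov` is the intended instance; [5] (124) not typed); MODEL carriers of n15-c FILE 130∕133∕145 and
(J-b′)(H)(L-1)…(L-3)(Ð-1)…(Ð-4) (global small-field gauge `u ≡ 1`; covariant Laplacian (3.50) ⊗ colour + FLAT nonlocal part (1.69) — not (3.26); `Reg336` idle ∕ no `D^{(2)}` term; King-block-mean
pairing; doubled torus; `L ≥ 7`; large cubes above a NON-EXPLICIT floor (print: «M ≥ M₁», Thm 3.1 p.397); crude constants) — ref-B READ-989 items (i)(iii)(iv)(v)(vi) untouched except that the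
site∕unit averaging is no longer forced flat.  NOT [B9] Thms 3.1∕3.2∕3.15 AS PRINTED.  N15 stays DISCHARGED OF RECORD AS CONSUMED (U-blind v7 pin, p687738) — no re-pin asked (a re-pin keyed
to THIS literal would fire FLAG №13 t2 by definition — the director's word, not mine), nothing re-claimed, no count moved (typed 28∕28 · discharged 8∕28); K3⁸ OPEN; finite 𝕋⁴ per index —
NOT ℝ⁴ ∕ OS ∕ mass gap ∕ Clay.  Two plumbing `def`s ⇒ review ∕ audit lane.  No `sorry`, `instance`, `notation`, `set_option`; standard axioms.
[cite: Balaban1985BackgroundPropagators, Thm 3.1 (3.42) p.397, Thm 3.2 (3.48) p.398, Thm 3.15 (3.187) p.432 (quantifier templates), §E pp.427–428 (Dirichlet region), (3.78)–(3.81) p.406 (perturbed averaging); Balaban1984PropagatorsII,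
Lemma 2.4 p.245, (2.154)–(2.156) pp.249–250; King1986, Lemma 4.5 (4.38) p.674 (A = 0 template)]
-/

noncomputable section

open scoped BigOperators Matrix Matrix.Norms.Frobenius Kronecker

namespace Summit.QuantumFields.YangMills.BalabanUVNodes.N15.SiteLayerSf

open Literature.MathematicalPhysics.QuantumFieldTheory.Balaban1983to89
open Literature.MathematicalPhysics.QuantumFieldTheory.Balaban1983to89.T4EtaRate (PairedInstance NE2PlusOperator NE2PlusSite NE2PlusUnit)
open Literature.MathematicalPhysics.QuantumFieldTheory.Balaban1983to89.T4EtaRateCoeffDefect (pull)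
open Literature.MathematicalPhysics.QuantumFieldTheory.Balaban1983to89.B11SectG (BlockNorm HasMaj)
open Literature.MathematicalPhysics.QuantumFieldTheory.Balaban1983to89.B5Prop11Plancherel (Tor fine)
open Literature.MathematicalPhysics.QuantumFieldTheory.Balaban1983to89.B6UnitTorusCarrier (unitTorusGeo)
open Literature.MathematicalPhysics.QuantumFieldTheory.King1986.Torus (blockOf)
open Literature.Barriers.QuantumFields (traceForm)
open Summit.QuantumFields.YangMills.BalabanUVNodes.N15.VectorPiece (kingPrV)
open Summit.QuantumFields.YangMills.BalabanUVNodes.N15.MatrixSpecies (liftBlk liftMap)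
open Summit.QuantumFields.YangMills.BalabanUVNodes.N15.Gluing (SfIdx sfInstance sfFamily CvX CvX' cvM cvBlk CvNorm)
open Summit.QuantumFields.YangMills.BalabanUVNodes.N15.GenuineRecord (sfE₄cov ne2PlusOperator_sf₄cov)
open Summit.QuantumFields.YangMills.BalabanUVNodes.N15.PairedFamilyGuard (Live)
open Literature.MathematicalPhysics.QuantumFieldTheory.Balaban1983to89.T4Continuum (T4Family ULoop)
open Node00 (NE2Objects₁₁)
open Summit.QuantumFields.YangMills.BalabanUVNodes.N15.AtKeyedHome (s_N15_of_admits)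
open YMDAG.UVSplit (Datum RateCarriers RateRecordPred N15At S_N15 ne2OfRecord₁₁)

variable (d : ℕ) {L : ℕ} [NeZero L] (mm ι : Type) [Fintype mm] [DecidableEq mm] [Fintype ι] [DecidableEq ι] (a : ℝ) (e : Matrix mm mm ℂ ≃L[ℝ] (ι → ℝ))

/-! ## §1 ★★★ The all-live knit with the perturbed averaging and the Dirichlet region -/

section Knit

/-- ★★★ **`Live ∧ N15At` FOR dag-n15-c's LIVE SMALL-FIELD FAMILY, ALL THREE LAYERS READING `A′`, THE SITE∕UNIT SANDWICH WITH A COVARIANTLY PERTURBED AVERAGING, GENUINE DIRICHLET REGION**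
(sub-family `SfIdxGE d L w × RegIdx0 d`; `d ≥ 1`, odd `L ≥ 7`, `a, c₃₅ > 0`, trace-form-orthonormal `e`, `ι` nonempty; directions `μ₁ μ₂` (operator), `α β` + colours `j j′` (site), `α′ β′` +
colours `j₂ j₂′` (unit), any `p`; ANY perturbation family `(Dc, Ec, Df, Ef)` with the displayed rows `hfam`): OPERATOR = Σ-F `ne2PlusOperator_sf₄cov`, SITE = (Q-3) `ne2PlusSite_foSiteCov`,
UNIT = (Q-4) `ne2PlusUnit_foCovCovLam` (`inΛ := inLamSf`), GUARD = (Ð-5) `live_sfGELam`. [bookkeeping] -/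
theorem live_and_n15At_sf₄cov_covQ_allLiveLam [Nonempty ι] (hd : 1 ≤ d) (hL : Odd L ∧ 1 < L) (hL7 : 7 ≤ L) (ha : 0 < a) {c35 : ℝ} (hc35 : 0 < c35)
    (he : ∀ A B : Matrix mm mm ℂ, traceForm A B = e A ⬝ᵥ e B) (μ₁ μ₂ α β : Fin (d + 1)) (j j' : ι) (α' β' : Fin (d + 1)) (j₂ j₂' : ι) (p : ℝ)
    (Dc : ∀ i : SfIdx d L, (Fin (d + 1) → CvX' d L i.m i.kk i.r hL → Matrix mm mm ℂ) → ((CvX d L i.m i.kk hL × ι → ℝ) →ₗ[ℝ] ((Tor (cvM d L i.m i.kk hL) × Fin (d + 1)) × ι → ℝ)))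
    (Ec : ∀ i : SfIdx d L, (Fin (d + 1) → CvX' d L i.m i.kk i.r hL → Matrix mm mm ℂ) → (((Tor (cvM d L i.m i.kk hL) × Fin (d + 1)) × ι → ℝ) →ₗ[ℝ] (CvX d L i.m i.kk hL × ι → ℝ)))
    (Df : ∀ i : SfIdx d L, (Fin (d + 1) → CvX' d L i.m i.kk i.r hL → Matrix mm mm ℂ) → ((CvX' d L i.m i.kk i.r hL × ι → ℝ) →ₗ[ℝ] ((Tor (cvM d L i.m i.kk hL) × Fin (d + 1)) × ι → ℝ)))
    (Ef : ∀ i : SfIdx d L, (Fin (d + 1) → CvX' d L i.m i.kk i.r hL → Matrix mm mm ℂ) → (((Tor (cvM d L i.m i.kk hL) × Fin (d + 1)) × ι → ℝ) →ₗ[ℝ] (CvX' d L i.m i.kk i.r hL × ι → ℝ)))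
    (hfam : ∀ ρ : ℝ, 0 < ρ → ∃ KD s₀ : ℝ, 0 ≤ KD ∧ 0 < s₀ ∧
      ∀ (i : SfIdx d L) (α₀ : ℝ) (A' : Fin (d + 1) → CvX' d L i.m i.kk i.r hL → Matrix mm mm ℂ), 0 < α₀ → c35 * (L : ℝ) ^ i.m * α₀ ≤ s₀ → (sfInstance d mm ι hL i).Bf.Reg335 c35 α₀ A' →
        HasMaj (CvNorm d L i.m i.kk hL ι) (BlockNorm.ofBlocks (unitTorusGeo L i.kk (cvM d L i.m i.kk hL)) (liftBlk (fun b : Tor (cvM d L i.m i.kk hL) × Fin (d + 1) => b.1) ι)) (Dc i A')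
          (fun y y' => KD * (c35 * (L : ℝ) ^ i.m * α₀) * Real.exp (-(ρ * (unitTorusGeo L i.kk (cvM d L i.m i.kk hL)).dist y y'))) ∧
        HasMaj (BlockNorm.ofBlocks (unitTorusGeo L i.kk (cvM d L i.m i.kk hL)) (liftBlk (fun b : CvX' d L i.m i.kk i.r hL => blockOf (L ^ i.r * L ^ i.kk) (cvM d L i.m i.kk hL) b.1) ι))
          (BlockNorm.ofBlocks (unitTorusGeo L i.kk (cvM d L i.m i.kk hL)) (liftBlk (fun b : Tor (cvM d L i.m i.kk hL) × Fin (d + 1) => b.1) ι)) (Df i A')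
          (fun y y' => KD * (c35 * (L : ℝ) ^ i.m * α₀) * Real.exp (-(ρ * (unitTorusGeo L i.kk (cvM d L i.m i.kk hL)).dist y y'))) ∧
        HasMaj (BlockNorm.ofBlocks (unitTorusGeo L i.kk (cvM d L i.m i.kk hL)) (liftBlk (fun b : Tor (cvM d L i.m i.kk hL) × Fin (d + 1) => b.1) ι)) (CvNorm d L i.m i.kk hL ι) (Ec i A')
          (fun y y' => KD * (c35 * (L : ℝ) ^ i.m * α₀) * Real.exp (-(ρ * (unitTorusGeo L i.kk (cvM d L i.m i.kk hL)).dist y y'))) ∧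
        HasMaj (BlockNorm.ofBlocks (unitTorusGeo L i.kk (cvM d L i.m i.kk hL)) (liftBlk (fun b : Tor (cvM d L i.m i.kk hL) × Fin (d + 1) => b.1) ι))
          (BlockNorm.ofBlocks (unitTorusGeo L i.kk (cvM d L i.m i.kk hL)) (liftBlk (fun b : CvX' d L i.m i.kk i.r hL => blockOf (L ^ i.r * L ^ i.kk) (cvM d L i.m i.kk hL) b.1) ι)) (Ef i A')
          (fun y y' => KD * (c35 * (L : ℝ) ^ i.m * α₀) * Real.exp (-(ρ * (unitTorusGeo L i.kk (cvM d L i.m i.kk hL)).dist y y'))) ∧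
        HasMaj (CvNorm d L i.m i.kk hL ι) (BlockNorm.ofBlocks (unitTorusGeo L i.kk (cvM d L i.m i.kk hL)) (liftBlk (fun b : Tor (cvM d L i.m i.kk hL) × Fin (d + 1) => b.1) ι))
          (Df i A' ∘ₗ pull (liftMap (kingPrV L i.kk i.r (cvM d L i.m i.kk hL)) ι) - Dc i A')
          (fun y y' => KD * ((((L ^ i.kk : ℕ) : ℝ)) ^ (-(1 / 16 : ℝ))) * Real.exp (-(ρ * (unitTorusGeo L i.kk (cvM d L i.m i.kk hL)).dist y y'))) ∧
        HasMaj (BlockNorm.ofBlocks (unitTorusGeo L i.kk (cvM d L i.m i.kk hL)) (liftBlk (fun b : Tor (cvM d L i.m i.kk hL) × Fin (d + 1) => b.1) ι))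
          (BlockNorm.ofBlocks (unitTorusGeo L i.kk (cvM d L i.m i.kk hL)) (liftBlk (fun b : CvX' d L i.m i.kk i.r hL => blockOf (L ^ i.r * L ^ i.kk) (cvM d L i.m i.kk hL) b.1) ι))
          (Ef i A' - pull (liftMap (kingPrV L i.kk i.r (cvM d L i.m i.kk hL)) ι) ∘ₗ Ec i A')
          (fun y y' => KD * ((((L ^ i.kk : ℕ) : ℝ)) ^ (-(1 / 16 : ℝ))) * Real.exp (-(ρ * (unitTorusGeo L i.kk (cvM d L i.m i.kk hL)).dist y y')))) :
    ∃ w : ℝ,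
      Live ⟨SfIdxGE d L w × RegIdx0 d, c35, p, fun x => sfInstance d mm ι hL x.1.1, fun x => sfFamily d mm ι a e hL x.1.1 (sfE₄cov d mm ι a e hL μ₁ μ₂ x.1.1),
          fun x => foSiteCov d mm ι a e hL α β j j' Dc Ec Df Ef x.1.1, fun x => foCovCovLam d mm ι a e hL α' β' j₂ j₂' Dc Ec Df Ef x.1.1 x.2.1, fun x => inLamSf d mm ι hL x.1.1 x.2.1,
          fun x => (sfInstance d mm ι hL x.1.1).gc.dist⟩ ∧
      N15At { I := SfIdxGE d L w × RegIdx0 d, c35 := c35, p := p, pi := fun x => sfInstance d mm ι hL x.1.1,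
              Kop := fun x => sfFamily d mm ι a e hL x.1.1 (sfE₄cov d mm ι a e hL μ₁ μ₂ x.1.1),
              Ksite := fun x => foSiteCov d mm ι a e hL α β j j' Dc Ec Df Ef x.1.1, Kunit := fun x => foCovCovLam d mm ι a e hL α' β' j₂ j₂' Dc Ec Df Ef x.1.1 x.2.1,
              inΛ := fun x => inLamSf d mm ι hL x.1.1 x.2.1, unitDist := fun x => (sfInstance d mm ι hL x.1.1).gc.dist } := by
  obtain ⟨w, hunit⟩ := ne2PlusUnit_foCovCovLam d mm ι a e hd hL hL7 ha hc35 he α' β' j₂ j₂' Dc Ec Df Ef hfam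
  exact ⟨w, live_sfGELam d mm ι hL w hc35.le p _ _ _,
    ⟨ne2PlusOperator_comp (fun x : SfIdxGE d L w × RegIdx0 d => x.1.1) (ne2PlusOperator_sf₄cov d mm ι e hL hL7 ha hc35 he μ₁ μ₂),
      ne2PlusSite_comp (fun x : SfIdxGE d L w × RegIdx0 d => x.1.1) (ne2PlusSite_foSiteCov d mm ι a e hL hL7 ha hc35 he α β j j' 4 p Dc Ec Df Ef hfam),
      ne2PlusUnit_comp (fun x : SfIdxGE d L w × RegIdx0 d => ((x.1, x.2.1) : SfIdxGE d L w × Finset (Fin (d + 1) → ℤ))) hunit⟩⟩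

/-! ## §2 The family-parametric road-(c) literal (pinned threshold); keyed face -/

/-- **THE ROAD-(c) LITERAL WITH ALL THREE LAYERS U-LIVE, A COVARIANTLY PERTURBED AVERAGING AND A GENUINE DIRICHLET REGION** at a size threshold `w`, for a perturbation family
`(Dc, Ec, Df, Ef)`: `NE2Objects₁₁` with n15-c's family on `SfIdxGE d L w × RegIdx0 d`, Σ-F's operator layer, (Q-3)'s site kernel, (Q-4)'s Dirichlet unit kernel and region predicate. [bookkeeping] -/
def sfObjects₄covQLam (hL : Odd L ∧ 1 < L) (μ₁ μ₂ α β : Fin (d + 1)) (j j' : ι) (α' β' : Fin (d + 1)) (j₂ j₂' : ι)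
    (Dc : ∀ i : SfIdx d L, (Fin (d + 1) → CvX' d L i.m i.kk i.r hL → Matrix mm mm ℂ) → ((CvX d L i.m i.kk hL × ι → ℝ) →ₗ[ℝ] ((Tor (cvM d L i.m i.kk hL) × Fin (d + 1)) × ι → ℝ)))
    (Ec : ∀ i : SfIdx d L, (Fin (d + 1) → CvX' d L i.m i.kk i.r hL → Matrix mm mm ℂ) → (((Tor (cvM d L i.m i.kk hL) × Fin (d + 1)) × ι → ℝ) →ₗ[ℝ] (CvX d L i.m i.kk hL × ι → ℝ)))
    (Df : ∀ i : SfIdx d L, (Fin (d + 1) → CvX' d L i.m i.kk i.r hL → Matrix mm mm ℂ) → ((CvX' d L i.m i.kk i.r hL × ι → ℝ) →ₗ[ℝ] ((Tor (cvM d L i.m i.kk hL) × Fin (d + 1)) × ι → ℝ)))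
    (Ef : ∀ i : SfIdx d L, (Fin (d + 1) → CvX' d L i.m i.kk i.r hL → Matrix mm mm ℂ) → (((Tor (cvM d L i.m i.kk hL) × Fin (d + 1)) × ι → ℝ) →ₗ[ℝ] (CvX' d L i.m i.kk i.r hL × ι → ℝ)))
    (c35 p w : ℝ) : NE2Objects₁₁ :=
  ⟨SfIdxGE d L w × RegIdx0 d, c35, p, fun x => sfInstance d mm ι hL x.1.1, fun x => sfFamily d mm ι a e hL x.1.1 (sfE₄cov d mm ι a e hL μ₁ μ₂ x.1.1),
    fun x => foSiteCov d mm ι a e hL α β j j' Dc Ec Df Ef x.1.1, fun x => foCovCovLam d mm ι a e hL α' β' j₂ j₂' Dc Ec Df Ef x.1.1 x.2.1, fun x => inLamSf d mm ι hL x.1.1 x.2.1,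
    fun x => (sfInstance d mm ι hL x.1.1).gc.dist⟩

/-- the record map reads the literal as the rates bundle (`rfl`). [bookkeeping] -/
theorem ne2OfRecord₁₁_sfObjects₄covQLam (hL : Odd L ∧ 1 < L) (μ₁ μ₂ α β : Fin (d + 1)) (j j' : ι) (α' β' : Fin (d + 1)) (j₂ j₂' : ι)
    (Dc : ∀ i : SfIdx d L, (Fin (d + 1) → CvX' d L i.m i.kk i.r hL → Matrix mm mm ℂ) → ((CvX d L i.m i.kk hL × ι → ℝ) →ₗ[ℝ] ((Tor (cvM d L i.m i.kk hL) × Fin (d + 1)) × ι → ℝ)))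
    (Ec : ∀ i : SfIdx d L, (Fin (d + 1) → CvX' d L i.m i.kk i.r hL → Matrix mm mm ℂ) → (((Tor (cvM d L i.m i.kk hL) × Fin (d + 1)) × ι → ℝ) →ₗ[ℝ] (CvX d L i.m i.kk hL × ι → ℝ)))
    (Df : ∀ i : SfIdx d L, (Fin (d + 1) → CvX' d L i.m i.kk i.r hL → Matrix mm mm ℂ) → ((CvX' d L i.m i.kk i.r hL × ι → ℝ) →ₗ[ℝ] ((Tor (cvM d L i.m i.kk hL) × Fin (d + 1)) × ι → ℝ)))
    (Ef : ∀ i : SfIdx d L, (Fin (d + 1) → CvX' d L i.m i.kk i.r hL → Matrix mm mm ℂ) → (((Tor (cvM d L i.m i.kk hL) × Fin (d + 1)) × ι → ℝ) →ₗ[ℝ] (CvX' d L i.m i.kk i.r hL × ι → ℝ)))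
    (c35 p w : ℝ) :
    ne2OfRecord₁₁ (sfObjects₄covQLam d mm ι a e hL μ₁ μ₂ α β j j' α' β' j₂ j₂' Dc Ec Df Ef c35 p w) =
      { I := SfIdxGE d L w × RegIdx0 d, c35 := c35, p := p, pi := fun x => sfInstance d mm ι hL x.1.1,
        Kop := fun x => sfFamily d mm ι a e hL x.1.1 (sfE₄cov d mm ι a e hL μ₁ μ₂ x.1.1),
        Ksite := fun x => foSiteCov d mm ι a e hL α β j j' Dc Ec Df Ef x.1.1, Kunit := fun x => foCovCovLam d mm ι a e hL α' β' j₂ j₂' Dc Ec Df Ef x.1.1 x.2.1,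
        inΛ := fun x => inLamSf d mm ι hL x.1.1 x.2.1, unitDist := fun x => (sfInstance d mm ι hL x.1.1).gc.dist } := rfl

/-- ★★ given the family's rows, there IS a threshold at which the literal passes the guard and `N15At` (restatement of §1 through the literal). [bookkeeping] -/
theorem exists_live_and_n15At_sfObjects₄covQLam [Nonempty ι] (hd : 1 ≤ d) (hL : Odd L ∧ 1 < L) (hL7 : 7 ≤ L) (ha : 0 < a) {c35 : ℝ} (hc35 : 0 < c35)
    (he : ∀ A B : Matrix mm mm ℂ, traceForm A B = e A ⬝ᵥ e B) (μ₁ μ₂ α β : Fin (d + 1)) (j j' : ι) (α' β' : Fin (d + 1)) (j₂ j₂' : ι) (p : ℝ)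
    (Dc : ∀ i : SfIdx d L, (Fin (d + 1) → CvX' d L i.m i.kk i.r hL → Matrix mm mm ℂ) → ((CvX d L i.m i.kk hL × ι → ℝ) →ₗ[ℝ] ((Tor (cvM d L i.m i.kk hL) × Fin (d + 1)) × ι → ℝ)))
    (Ec : ∀ i : SfIdx d L, (Fin (d + 1) → CvX' d L i.m i.kk i.r hL → Matrix mm mm ℂ) → (((Tor (cvM d L i.m i.kk hL) × Fin (d + 1)) × ι → ℝ) →ₗ[ℝ] (CvX d L i.m i.kk hL × ι → ℝ)))
    (Df : ∀ i : SfIdx d L, (Fin (d + 1) → CvX' d L i.m i.kk i.r hL → Matrix mm mm ℂ) → ((CvX' d L i.m i.kk i.r hL × ι → ℝ) →ₗ[ℝ] ((Tor (cvM d L i.m i.kk hL) × Fin (d + 1)) × ι → ℝ)))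
    (Ef : ∀ i : SfIdx d L, (Fin (d + 1) → CvX' d L i.m i.kk i.r hL → Matrix mm mm ℂ) → (((Tor (cvM d L i.m i.kk hL) × Fin (d + 1)) × ι → ℝ) →ₗ[ℝ] (CvX' d L i.m i.kk i.r hL × ι → ℝ)))
    (hfam : ∀ ρ : ℝ, 0 < ρ → ∃ KD s₀ : ℝ, 0 ≤ KD ∧ 0 < s₀ ∧
      ∀ (i : SfIdx d L) (α₀ : ℝ) (A' : Fin (d + 1) → CvX' d L i.m i.kk i.r hL → Matrix mm mm ℂ), 0 < α₀ → c35 * (L : ℝ) ^ i.m * α₀ ≤ s₀ → (sfInstance d mm ι hL i).Bf.Reg335 c35 α₀ A' →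
        HasMaj (CvNorm d L i.m i.kk hL ι) (BlockNorm.ofBlocks (unitTorusGeo L i.kk (cvM d L i.m i.kk hL)) (liftBlk (fun b : Tor (cvM d L i.m i.kk hL) × Fin (d + 1) => b.1) ι)) (Dc i A')
          (fun y y' => KD * (c35 * (L : ℝ) ^ i.m * α₀) * Real.exp (-(ρ * (unitTorusGeo L i.kk (cvM d L i.m i.kk hL)).dist y y'))) ∧
        HasMaj (BlockNorm.ofBlocks (unitTorusGeo L i.kk (cvM d L i.m i.kk hL)) (liftBlk (fun b : CvX' d L i.m i.kk i.r hL => blockOf (L ^ i.r * L ^ i.kk) (cvM d L i.m i.kk hL) b.1) ι))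
          (BlockNorm.ofBlocks (unitTorusGeo L i.kk (cvM d L i.m i.kk hL)) (liftBlk (fun b : Tor (cvM d L i.m i.kk hL) × Fin (d + 1) => b.1) ι)) (Df i A')
          (fun y y' => KD * (c35 * (L : ℝ) ^ i.m * α₀) * Real.exp (-(ρ * (unitTorusGeo L i.kk (cvM d L i.m i.kk hL)).dist y y'))) ∧
        HasMaj (BlockNorm.ofBlocks (unitTorusGeo L i.kk (cvM d L i.m i.kk hL)) (liftBlk (fun b : Tor (cvM d L i.m i.kk hL) × Fin (d + 1) => b.1) ι)) (CvNorm d L i.m i.kk hL ι) (Ec i A')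
          (fun y y' => KD * (c35 * (L : ℝ) ^ i.m * α₀) * Real.exp (-(ρ * (unitTorusGeo L i.kk (cvM d L i.m i.kk hL)).dist y y'))) ∧
        HasMaj (BlockNorm.ofBlocks (unitTorusGeo L i.kk (cvM d L i.m i.kk hL)) (liftBlk (fun b : Tor (cvM d L i.m i.kk hL) × Fin (d + 1) => b.1) ι))
          (BlockNorm.ofBlocks (unitTorusGeo L i.kk (cvM d L i.m i.kk hL)) (liftBlk (fun b : CvX' d L i.m i.kk i.r hL => blockOf (L ^ i.r * L ^ i.kk) (cvM d L i.m i.kk hL) b.1) ι)) (Ef i A')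
          (fun y y' => KD * (c35 * (L : ℝ) ^ i.m * α₀) * Real.exp (-(ρ * (unitTorusGeo L i.kk (cvM d L i.m i.kk hL)).dist y y'))) ∧
        HasMaj (CvNorm d L i.m i.kk hL ι) (BlockNorm.ofBlocks (unitTorusGeo L i.kk (cvM d L i.m i.kk hL)) (liftBlk (fun b : Tor (cvM d L i.m i.kk hL) × Fin (d + 1) => b.1) ι))
          (Df i A' ∘ₗ pull (liftMap (kingPrV L i.kk i.r (cvM d L i.m i.kk hL)) ι) - Dc i A')
          (fun y y' => KD * ((((L ^ i.kk : ℕ) : ℝ)) ^ (-(1 / 16 : ℝ))) * Real.exp (-(ρ * (unitTorusGeo L i.kk (cvM d L i.m i.kk hL)).dist y y'))) ∧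
        HasMaj (BlockNorm.ofBlocks (unitTorusGeo L i.kk (cvM d L i.m i.kk hL)) (liftBlk (fun b : Tor (cvM d L i.m i.kk hL) × Fin (d + 1) => b.1) ι))
          (BlockNorm.ofBlocks (unitTorusGeo L i.kk (cvM d L i.m i.kk hL)) (liftBlk (fun b : CvX' d L i.m i.kk i.r hL => blockOf (L ^ i.r * L ^ i.kk) (cvM d L i.m i.kk hL) b.1) ι))
          (Ef i A' - pull (liftMap (kingPrV L i.kk i.r (cvM d L i.m i.kk hL)) ι) ∘ₗ Ec i A')
          (fun y y' => KD * ((((L ^ i.kk : ℕ) : ℝ)) ^ (-(1 / 16 : ℝ))) * Real.exp (-(ρ * (unitTorusGeo L i.kk (cvM d L i.m i.kk hL)).dist y y')))) :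
    ∃ w : ℝ, Live (ne2OfRecord₁₁ (sfObjects₄covQLam d mm ι a e hL μ₁ μ₂ α β j j' α' β' j₂ j₂' Dc Ec Df Ef c35 p w)) ∧
      N15At (ne2OfRecord₁₁ (sfObjects₄covQLam d mm ι a e hL μ₁ μ₂ α β j j' α' β' j₂ j₂' Dc Ec Df Ef c35 p w)) :=
  live_and_n15At_sf₄cov_covQ_allLiveLam d mm ι a e hd hL hL7 ha hc35 he μ₁ μ₂ α β j j' α' β' j₂ j₂' p Dc Ec Df Ef hfam

/-- **THE PINNED THRESHOLD** `w_Q` for a family with rows (a `Classical.choose` — NON-EXPLICIT cube floor; depends on `(d, L, mm, ι, a, e, c₃₅, directions, colours, p)`, the family AND the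
proof of its rows). [bookkeeping] -/
def wQLam [Nonempty ι] (hd : 1 ≤ d) (hL : Odd L ∧ 1 < L) (hL7 : 7 ≤ L) (ha : 0 < a) {c35 : ℝ} (hc35 : 0 < c35) (he : ∀ A B : Matrix mm mm ℂ, traceForm A B = e A ⬝ᵥ e B)
    (μ₁ μ₂ α β : Fin (d + 1)) (j j' : ι) (α' β' : Fin (d + 1)) (j₂ j₂' : ι) (p : ℝ)
    (Dc : ∀ i : SfIdx d L, (Fin (d + 1) → CvX' d L i.m i.kk i.r hL → Matrix mm mm ℂ) → ((CvX d L i.m i.kk hL × ι → ℝ) →ₗ[ℝ] ((Tor (cvM d L i.m i.kk hL) × Fin (d + 1)) × ι → ℝ)))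
    (Ec : ∀ i : SfIdx d L, (Fin (d + 1) → CvX' d L i.m i.kk i.r hL → Matrix mm mm ℂ) → (((Tor (cvM d L i.m i.kk hL) × Fin (d + 1)) × ι → ℝ) →ₗ[ℝ] (CvX d L i.m i.kk hL × ι → ℝ)))
    (Df : ∀ i : SfIdx d L, (Fin (d + 1) → CvX' d L i.m i.kk i.r hL → Matrix mm mm ℂ) → ((CvX' d L i.m i.kk i.r hL × ι → ℝ) →ₗ[ℝ] ((Tor (cvM d L i.m i.kk hL) × Fin (d + 1)) × ι → ℝ)))
    (Ef : ∀ i : SfIdx d L, (Fin (d + 1) → CvX' d L i.m i.kk i.r hL → Matrix mm mm ℂ) → (((Tor (cvM d L i.m i.kk hL) × Fin (d + 1)) × ι → ℝ) →ₗ[ℝ] (CvX' d L i.m i.kk i.r hL × ι → ℝ)))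
    (hfam : ∀ ρ : ℝ, 0 < ρ → ∃ KD s₀ : ℝ, 0 ≤ KD ∧ 0 < s₀ ∧
      ∀ (i : SfIdx d L) (α₀ : ℝ) (A' : Fin (d + 1) → CvX' d L i.m i.kk i.r hL → Matrix mm mm ℂ), 0 < α₀ → c35 * (L : ℝ) ^ i.m * α₀ ≤ s₀ → (sfInstance d mm ι hL i).Bf.Reg335 c35 α₀ A' →
        HasMaj (CvNorm d L i.m i.kk hL ι) (BlockNorm.ofBlocks (unitTorusGeo L i.kk (cvM d L i.m i.kk hL)) (liftBlk (fun b : Tor (cvM d L i.m i.kk hL) × Fin (d + 1) => b.1) ι)) (Dc i A')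
          (fun y y' => KD * (c35 * (L : ℝ) ^ i.m * α₀) * Real.exp (-(ρ * (unitTorusGeo L i.kk (cvM d L i.m i.kk hL)).dist y y'))) ∧
        HasMaj (BlockNorm.ofBlocks (unitTorusGeo L i.kk (cvM d L i.m i.kk hL)) (liftBlk (fun b : CvX' d L i.m i.kk i.r hL => blockOf (L ^ i.r * L ^ i.kk) (cvM d L i.m i.kk hL) b.1) ι))
          (BlockNorm.ofBlocks (unitTorusGeo L i.kk (cvM d L i.m i.kk hL)) (liftBlk (fun b : Tor (cvM d L i.m i.kk hL) × Fin (d + 1) => b.1) ι)) (Df i A')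
          (fun y y' => KD * (c35 * (L : ℝ) ^ i.m * α₀) * Real.exp (-(ρ * (unitTorusGeo L i.kk (cvM d L i.m i.kk hL)).dist y y'))) ∧
        HasMaj (BlockNorm.ofBlocks (unitTorusGeo L i.kk (cvM d L i.m i.kk hL)) (liftBlk (fun b : Tor (cvM d L i.m i.kk hL) × Fin (d + 1) => b.1) ι)) (CvNorm d L i.m i.kk hL ι) (Ec i A')
          (fun y y' => KD * (c35 * (L : ℝ) ^ i.m * α₀) * Real.exp (-(ρ * (unitTorusGeo L i.kk (cvM d L i.m i.kk hL)).dist y y'))) ∧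
        HasMaj (BlockNorm.ofBlocks (unitTorusGeo L i.kk (cvM d L i.m i.kk hL)) (liftBlk (fun b : Tor (cvM d L i.m i.kk hL) × Fin (d + 1) => b.1) ι))
          (BlockNorm.ofBlocks (unitTorusGeo L i.kk (cvM d L i.m i.kk hL)) (liftBlk (fun b : CvX' d L i.m i.kk i.r hL => blockOf (L ^ i.r * L ^ i.kk) (cvM d L i.m i.kk hL) b.1) ι)) (Ef i A')
          (fun y y' => KD * (c35 * (L : ℝ) ^ i.m * α₀) * Real.exp (-(ρ * (unitTorusGeo L i.kk (cvM d L i.m i.kk hL)).dist y y'))) ∧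
        HasMaj (CvNorm d L i.m i.kk hL ι) (BlockNorm.ofBlocks (unitTorusGeo L i.kk (cvM d L i.m i.kk hL)) (liftBlk (fun b : Tor (cvM d L i.m i.kk hL) × Fin (d + 1) => b.1) ι))
          (Df i A' ∘ₗ pull (liftMap (kingPrV L i.kk i.r (cvM d L i.m i.kk hL)) ι) - Dc i A')
          (fun y y' => KD * ((((L ^ i.kk : ℕ) : ℝ)) ^ (-(1 / 16 : ℝ))) * Real.exp (-(ρ * (unitTorusGeo L i.kk (cvM d L i.m i.kk hL)).dist y y'))) ∧
        HasMaj (BlockNorm.ofBlocks (unitTorusGeo L i.kk (cvM d L i.m i.kk hL)) (liftBlk (fun b : Tor (cvM d L i.m i.kk hL) × Fin (d + 1) => b.1) ι))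
          (BlockNorm.ofBlocks (unitTorusGeo L i.kk (cvM d L i.m i.kk hL)) (liftBlk (fun b : CvX' d L i.m i.kk i.r hL => blockOf (L ^ i.r * L ^ i.kk) (cvM d L i.m i.kk hL) b.1) ι))
          (Ef i A' - pull (liftMap (kingPrV L i.kk i.r (cvM d L i.m i.kk hL)) ι) ∘ₗ Ec i A')
          (fun y y' => KD * ((((L ^ i.kk : ℕ) : ℝ)) ^ (-(1 / 16 : ℝ))) * Real.exp (-(ρ * (unitTorusGeo L i.kk (cvM d L i.m i.kk hL)).dist y y')))) : ℝ :=
  Classical.choose (exists_live_and_n15At_sfObjects₄covQLam d mm ι a e hd hL hL7 ha hc35 he μ₁ μ₂ α β j j' α' β' j₂ j₂' p Dc Ec Df Ef hfam)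

/-- ★★★ **GUARD ∧ `N15At` AT THE COVARIANTLY AVERAGED DIRICHLET ALL-LIVE LITERAL PINNED AT `w_Q`** (`d ≥ 1`, odd `L ≥ 7`, `a, c₃₅ > 0`, trace-form-orthonormal `e`, `ι` nonempty, a family with
rows) — a CLOSED literal given the family: NO U-blind layer, NO `⊤` region, NO flat averaging forced in the sandwich. [bookkeeping] -/
theorem live_and_n15At_sfObjects₄covQLam_wQLam [Nonempty ι] (hd : 1 ≤ d) (hL : Odd L ∧ 1 < L) (hL7 : 7 ≤ L) (ha : 0 < a) {c35 : ℝ} (hc35 : 0 < c35)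
    (he : ∀ A B : Matrix mm mm ℂ, traceForm A B = e A ⬝ᵥ e B) (μ₁ μ₂ α β : Fin (d + 1)) (j j' : ι) (α' β' : Fin (d + 1)) (j₂ j₂' : ι) (p : ℝ)
    (Dc : ∀ i : SfIdx d L, (Fin (d + 1) → CvX' d L i.m i.kk i.r hL → Matrix mm mm ℂ) → ((CvX d L i.m i.kk hL × ι → ℝ) →ₗ[ℝ] ((Tor (cvM d L i.m i.kk hL) × Fin (d + 1)) × ι → ℝ)))
    (Ec : ∀ i : SfIdx d L, (Fin (d + 1) → CvX' d L i.m i.kk i.r hL → Matrix mm mm ℂ) → (((Tor (cvM d L i.m i.kk hL) × Fin (d + 1)) × ι → ℝ) →ₗ[ℝ] (CvX d L i.m i.kk hL × ι → ℝ)))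
    (Df : ∀ i : SfIdx d L, (Fin (d + 1) → CvX' d L i.m i.kk i.r hL → Matrix mm mm ℂ) → ((CvX' d L i.m i.kk i.r hL × ι → ℝ) →ₗ[ℝ] ((Tor (cvM d L i.m i.kk hL) × Fin (d + 1)) × ι → ℝ)))
    (Ef : ∀ i : SfIdx d L, (Fin (d + 1) → CvX' d L i.m i.kk i.r hL → Matrix mm mm ℂ) → (((Tor (cvM d L i.m i.kk hL) × Fin (d + 1)) × ι → ℝ) →ₗ[ℝ] (CvX' d L i.m i.kk i.r hL × ι → ℝ)))
    (hfam : ∀ ρ : ℝ, 0 < ρ → ∃ KD s₀ : ℝ, 0 ≤ KD ∧ 0 < s₀ ∧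
      ∀ (i : SfIdx d L) (α₀ : ℝ) (A' : Fin (d + 1) → CvX' d L i.m i.kk i.r hL → Matrix mm mm ℂ), 0 < α₀ → c35 * (L : ℝ) ^ i.m * α₀ ≤ s₀ → (sfInstance d mm ι hL i).Bf.Reg335 c35 α₀ A' →
        HasMaj (CvNorm d L i.m i.kk hL ι) (BlockNorm.ofBlocks (unitTorusGeo L i.kk (cvM d L i.m i.kk hL)) (liftBlk (fun b : Tor (cvM d L i.m i.kk hL) × Fin (d + 1) => b.1) ι)) (Dc i A')
          (fun y y' => KD * (c35 * (L : ℝ) ^ i.m * α₀) * Real.exp (-(ρ * (unitTorusGeo L i.kk (cvM d L i.m i.kk hL)).dist y y'))) ∧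
        HasMaj (BlockNorm.ofBlocks (unitTorusGeo L i.kk (cvM d L i.m i.kk hL)) (liftBlk (fun b : CvX' d L i.m i.kk i.r hL => blockOf (L ^ i.r * L ^ i.kk) (cvM d L i.m i.kk hL) b.1) ι))
          (BlockNorm.ofBlocks (unitTorusGeo L i.kk (cvM d L i.m i.kk hL)) (liftBlk (fun b : Tor (cvM d L i.m i.kk hL) × Fin (d + 1) => b.1) ι)) (Df i A')
          (fun y y' => KD * (c35 * (L : ℝ) ^ i.m * α₀) * Real.exp (-(ρ * (unitTorusGeo L i.kk (cvM d L i.m i.kk hL)).dist y y'))) ∧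
        HasMaj (BlockNorm.ofBlocks (unitTorusGeo L i.kk (cvM d L i.m i.kk hL)) (liftBlk (fun b : Tor (cvM d L i.m i.kk hL) × Fin (d + 1) => b.1) ι)) (CvNorm d L i.m i.kk hL ι) (Ec i A')
          (fun y y' => KD * (c35 * (L : ℝ) ^ i.m * α₀) * Real.exp (-(ρ * (unitTorusGeo L i.kk (cvM d L i.m i.kk hL)).dist y y'))) ∧
        HasMaj (BlockNorm.ofBlocks (unitTorusGeo L i.kk (cvM d L i.m i.kk hL)) (liftBlk (fun b : Tor (cvM d L i.m i.kk hL) × Fin (d + 1) => b.1) ι))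
          (BlockNorm.ofBlocks (unitTorusGeo L i.kk (cvM d L i.m i.kk hL)) (liftBlk (fun b : CvX' d L i.m i.kk i.r hL => blockOf (L ^ i.r * L ^ i.kk) (cvM d L i.m i.kk hL) b.1) ι)) (Ef i A')
          (fun y y' => KD * (c35 * (L : ℝ) ^ i.m * α₀) * Real.exp (-(ρ * (unitTorusGeo L i.kk (cvM d L i.m i.kk hL)).dist y y'))) ∧
        HasMaj (CvNorm d L i.m i.kk hL ι) (BlockNorm.ofBlocks (unitTorusGeo L i.kk (cvM d L i.m i.kk hL)) (liftBlk (fun b : Tor (cvM d L i.m i.kk hL) × Fin (d + 1) => b.1) ι))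
          (Df i A' ∘ₗ pull (liftMap (kingPrV L i.kk i.r (cvM d L i.m i.kk hL)) ι) - Dc i A')
          (fun y y' => KD * ((((L ^ i.kk : ℕ) : ℝ)) ^ (-(1 / 16 : ℝ))) * Real.exp (-(ρ * (unitTorusGeo L i.kk (cvM d L i.m i.kk hL)).dist y y'))) ∧
        HasMaj (BlockNorm.ofBlocks (unitTorusGeo L i.kk (cvM d L i.m i.kk hL)) (liftBlk (fun b : Tor (cvM d L i.m i.kk hL) × Fin (d + 1) => b.1) ι))
          (BlockNorm.ofBlocks (unitTorusGeo L i.kk (cvM d L i.m i.kk hL)) (liftBlk (fun b : CvX' d L i.m i.kk i.r hL => blockOf (L ^ i.r * L ^ i.kk) (cvM d L i.m i.kk hL) b.1) ι))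
          (Ef i A' - pull (liftMap (kingPrV L i.kk i.r (cvM d L i.m i.kk hL)) ι) ∘ₗ Ec i A')
          (fun y y' => KD * ((((L ^ i.kk : ℕ) : ℝ)) ^ (-(1 / 16 : ℝ))) * Real.exp (-(ρ * (unitTorusGeo L i.kk (cvM d L i.m i.kk hL)).dist y y')))) :
    Live (ne2OfRecord₁₁ (sfObjects₄covQLam d mm ι a e hL μ₁ μ₂ α β j j' α' β' j₂ j₂' Dc Ec Df Ef c35 p
        (wQLam d mm ι a e hd hL hL7 ha hc35 he μ₁ μ₂ α β j j' α' β' j₂ j₂' p Dc Ec Df Ef hfam))) ∧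
      N15At (ne2OfRecord₁₁ (sfObjects₄covQLam d mm ι a e hL μ₁ μ₂ α β j j' α' β' j₂ j₂' Dc Ec Df Ef c35 p
        (wQLam d mm ι a e hd hL hL7 ha hc35 he μ₁ μ₂ α β j j' α' β' j₂ j₂' p Dc Ec Df Ef hfam))) :=
  Classical.choose_spec (exists_live_and_n15At_sfObjects₄covQLam d mm ι a e hd hL hL7 ha hc35 he μ₁ μ₂ α β j j' α' β' j₂ j₂' p Dc Ec Df Ef hfam)

variable {N : ℕ} [NeZero N] {key : (F : T4Family) → Datum F N → Prop}

/-- ★★ **THE COVARIANTLY AVERAGED DIRICHLET ALL-LIVE LITERAL AT ANY KEYED HOME** (part 30's interface): a rate home over ANY key admitting only the literals of a key-indexed NE2 reading whose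
value everywhere is the pinned literal (for a fixed family with rows) has `S_N15 RRec`. [bookkeeping] -/
theorem s_N15_of_admits_sf₄covQLam [Nonempty ι] (hd : 1 ≤ d) (hL : Odd L ∧ 1 < L) (hL7 : 7 ≤ L) (ha : 0 < a) {c35 : ℝ} (hc35 : 0 < c35)
    (he : ∀ A B : Matrix mm mm ℂ, traceForm A B = e A ⬝ᵥ e B) (μ₁ μ₂ α β : Fin (d + 1)) (j j' : ι) (α' β' : Fin (d + 1)) (j₂ j₂' : ι) (p : ℝ)
    (Dc : ∀ i : SfIdx d L, (Fin (d + 1) → CvX' d L i.m i.kk i.r hL → Matrix mm mm ℂ) → ((CvX d L i.m i.kk hL × ι → ℝ) →ₗ[ℝ] ((Tor (cvM d L i.m i.kk hL) × Fin (d + 1)) × ι → ℝ)))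
    (Ec : ∀ i : SfIdx d L, (Fin (d + 1) → CvX' d L i.m i.kk i.r hL → Matrix mm mm ℂ) → (((Tor (cvM d L i.m i.kk hL) × Fin (d + 1)) × ι → ℝ) →ₗ[ℝ] (CvX d L i.m i.kk hL × ι → ℝ)))
    (Df : ∀ i : SfIdx d L, (Fin (d + 1) → CvX' d L i.m i.kk i.r hL → Matrix mm mm ℂ) → ((CvX' d L i.m i.kk i.r hL × ι → ℝ) →ₗ[ℝ] ((Tor (cvM d L i.m i.kk hL) × Fin (d + 1)) × ι → ℝ)))
    (Ef : ∀ i : SfIdx d L, (Fin (d + 1) → CvX' d L i.m i.kk i.r hL → Matrix mm mm ℂ) → (((Tor (cvM d L i.m i.kk hL) × Fin (d + 1)) × ι → ℝ) →ₗ[ℝ] (CvX' d L i.m i.kk i.r hL × ι → ℝ)))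
    (hfam : ∀ ρ : ℝ, 0 < ρ → ∃ KD s₀ : ℝ, 0 ≤ KD ∧ 0 < s₀ ∧
      ∀ (i : SfIdx d L) (α₀ : ℝ) (A' : Fin (d + 1) → CvX' d L i.m i.kk i.r hL → Matrix mm mm ℂ), 0 < α₀ → c35 * (L : ℝ) ^ i.m * α₀ ≤ s₀ → (sfInstance d mm ι hL i).Bf.Reg335 c35 α₀ A' →
        HasMaj (CvNorm d L i.m i.kk hL ι) (BlockNorm.ofBlocks (unitTorusGeo L i.kk (cvM d L i.m i.kk hL)) (liftBlk (fun b : Tor (cvM d L i.m i.kk hL) × Fin (d + 1) => b.1) ι)) (Dc i A')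
          (fun y y' => KD * (c35 * (L : ℝ) ^ i.m * α₀) * Real.exp (-(ρ * (unitTorusGeo L i.kk (cvM d L i.m i.kk hL)).dist y y'))) ∧
        HasMaj (BlockNorm.ofBlocks (unitTorusGeo L i.kk (cvM d L i.m i.kk hL)) (liftBlk (fun b : CvX' d L i.m i.kk i.r hL => blockOf (L ^ i.r * L ^ i.kk) (cvM d L i.m i.kk hL) b.1) ι))
          (BlockNorm.ofBlocks (unitTorusGeo L i.kk (cvM d L i.m i.kk hL)) (liftBlk (fun b : Tor (cvM d L i.m i.kk hL) × Fin (d + 1) => b.1) ι)) (Df i A')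
          (fun y y' => KD * (c35 * (L : ℝ) ^ i.m * α₀) * Real.exp (-(ρ * (unitTorusGeo L i.kk (cvM d L i.m i.kk hL)).dist y y'))) ∧
        HasMaj (BlockNorm.ofBlocks (unitTorusGeo L i.kk (cvM d L i.m i.kk hL)) (liftBlk (fun b : Tor (cvM d L i.m i.kk hL) × Fin (d + 1) => b.1) ι)) (CvNorm d L i.m i.kk hL ι) (Ec i A')
          (fun y y' => KD * (c35 * (L : ℝ) ^ i.m * α₀) * Real.exp (-(ρ * (unitTorusGeo L i.kk (cvM d L i.m i.kk hL)).dist y y'))) ∧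
        HasMaj (BlockNorm.ofBlocks (unitTorusGeo L i.kk (cvM d L i.m i.kk hL)) (liftBlk (fun b : Tor (cvM d L i.m i.kk hL) × Fin (d + 1) => b.1) ι))
          (BlockNorm.ofBlocks (unitTorusGeo L i.kk (cvM d L i.m i.kk hL)) (liftBlk (fun b : CvX' d L i.m i.kk i.r hL => blockOf (L ^ i.r * L ^ i.kk) (cvM d L i.m i.kk hL) b.1) ι)) (Ef i A')
          (fun y y' => KD * (c35 * (L : ℝ) ^ i.m * α₀) * Real.exp (-(ρ * (unitTorusGeo L i.kk (cvM d L i.m i.kk hL)).dist y y'))) ∧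
        HasMaj (CvNorm d L i.m i.kk hL ι) (BlockNorm.ofBlocks (unitTorusGeo L i.kk (cvM d L i.m i.kk hL)) (liftBlk (fun b : Tor (cvM d L i.m i.kk hL) × Fin (d + 1) => b.1) ι))
          (Df i A' ∘ₗ pull (liftMap (kingPrV L i.kk i.r (cvM d L i.m i.kk hL)) ι) - Dc i A')
          (fun y y' => KD * ((((L ^ i.kk : ℕ) : ℝ)) ^ (-(1 / 16 : ℝ))) * Real.exp (-(ρ * (unitTorusGeo L i.kk (cvM d L i.m i.kk hL)).dist y y'))) ∧
        HasMaj (BlockNorm.ofBlocks (unitTorusGeo L i.kk (cvM d L i.m i.kk hL)) (liftBlk (fun b : Tor (cvM d L i.m i.kk hL) × Fin (d + 1) => b.1) ι))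
          (BlockNorm.ofBlocks (unitTorusGeo L i.kk (cvM d L i.m i.kk hL)) (liftBlk (fun b : CvX' d L i.m i.kk i.r hL => blockOf (L ^ i.r * L ^ i.kk) (cvM d L i.m i.kk hL) b.1) ι))
          (Ef i A' - pull (liftMap (kingPrV L i.kk i.r (cvM d L i.m i.kk hL)) ι) ∘ₗ Ec i A')
          (fun y y' => KD * ((((L ^ i.kk : ℕ) : ℝ)) ^ (-(1 / 16 : ℝ))) * Real.exp (-(ρ * (unitTorusGeo L i.kk (cvM d L i.m i.kk hL)).dist y y'))))
    (ne2At : ∀ {F : T4Family} {D : Datum F N}, key F D → (ℕ → ℝ) → List (ULoop F) → ℕ → NE2Objects₁₁) (RRec : RateRecordPred N)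
    (hadm : ∀ (F : T4Family) (D : Datum F N) (g₀ : ℕ → ℝ) (os : List (ULoop F)) (R : RateCarriers N), RRec F D g₀ os R →
      ∃ (h : key F D) (k : ℕ), R.ne2 = ne2OfRecord₁₁ (ne2At h g₀ os k))
    (h : ∀ (F : T4Family) (D : Datum F N) (h : key F D) (g₀ : ℕ → ℝ) (os : List (ULoop F)) (k : ℕ),
      ne2At h g₀ os k = sfObjects₄covQLam d mm ι a e hL μ₁ μ₂ α β j j' α' β' j₂ j₂' Dc Ec Df Ef c35 p
        (wQLam d mm ι a e hd hL hL7 ha hc35 he μ₁ μ₂ α β j j' α' β' j₂ j₂' p Dc Ec Df Ef hfam)) :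
    S_N15 RRec :=
  s_N15_of_admits ne2At RRec hadm fun F D hk g₀ os k => by
    rw [h F D hk g₀ os k]
    exact (live_and_n15At_sfObjects₄covQLam_wQLam d mm ι a e hd hL hL7 ha hc35 he μ₁ μ₂ α β j j' α' β' j₂ j₂' p Dc Ec Df Ef hfam).2

end Knit

end Summit.QuantumFields.YangMills.BalabanUVNodes.N15.SiteLayerSf

end
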